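import Summits.CriticalPhenomena.PercolationContinuityZ3.Theorems.PercNearOneGluingNoHeavyQuantFarHubFamilyDecouple
import Summits.CriticalPhenomena.PercolationContinuityZ3.Theorems.PercNearOneGluingNoHeavyQuantFarCycleBlockLaw
import HarnessLib

/-!
# QUANT lane R8, front "FAR beyond trees", layer one — HUB FAMILIES III: the stem count of the hub-decoupled block of an ARBITRARY pendant block
# and its laws (`P_{w'}(X ≥ 1) = hProd`, `P_{w'}(X ≥ 2) = tProd` of the chain of core marginals `m_j = P_w(c ↔ v j in core)`)

builds on p205010 (kernel theorem, internal audit signed; external expert review pending)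

Support file (`--supports stmt-CriticalPhenomena-4575`), seat `prim-quant-p1` (gen 22); memo
`run/shared/lean/prim/quant/prim-quant-p1-g22/FOR-LEAD-KHUB.md` §6.  Standard axioms; no sorries.  Core-agnostic version of `…QuantFarCycleBlockStems`.

* `Block.mchain μ v S A w pre ps : TwoChain` — arms `A i = μ (p_i)`, `B = 0` (so `m i = μ (p_i)`), hub laws of the listed anchors; `Block.mchain_shift`;
* `Block.fstemCountL`, `Block.fstemSet`; `Block.floadedList J v S A` (the loaded indices of `J`), `Block.stemCountF_eq_fstemCountL`;
* **`Block.real_fstemCountL`** — under `w' = Block.fdecouple c Z J v S w`: `P_{w'}(fstemCountL ps ≥ 1) = hProd |ps| C`, `P_{w'}(fstemCountL ps ≥ 2) = tProd |ps| C`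
  for `C = mchain (j ↦ P_w(c ↔ v j in core)) v S A w pre ps` and any duplicate-free list `ps` of indices of `J`.
[cite: Grimmett1999, §1.3 p. 10; §2.2]; bookkeeping [this work].
-/

noncomputable section

namespace Summit.CriticalPhenomena.PercolationContinuityZ3.Theorems

namespace Quant

namespace Block

open Finset MeasureTheory Set
open Literature.Probability.LatticeModels
open Literature.Probability.Percolation
open TwoChain (hProd tProd)
open scoped Classical

variable {n : ℕ}

/-! ## The chain of marginals and the stem count over a list -/

/-- The chain of a list of anchors with prescribed marginals `μ`: `A i = μ p_i`, `B = 0`, hub laws of the anchors. [this work] -/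
def mchain (μ : ℕ → ℝ) (v : ℕ → Fin n) (S : ℕ → Finset (Fin n)) (A : Finset (Fin n)) (w : Sym2 (Fin n) → unitInterval) (pre : ℕ) (ps : List ℕ) :
    TwoChain :=
  ⟨fun i => μ (lpos 0 pre ps i), fun _ => 0, fun i => hz v S A w (lpos 0 pre ps i), fun i => hs v S A w (lpos 0 pre ps i),
    fun i => hd v S A w (lpos 0 pre ps i)⟩

/-- `(mchain μ … pre (p :: ps)).shift = mchain μ … p ps`. [this work] -/
theorem mchain_shift (μ : ℕ → ℝ) (v : ℕ → Fin n) (S : ℕ → Finset (Fin n)) (A : Finset (Fin n)) (w : Sym2 (Fin n) → unitInterval) (pre p : ℕ)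
    (ps : List ℕ) : (mchain μ v S A w pre (p :: ps)).shift = mchain μ v S A w p ps := by
  simp only [TwoChain.shift, mchain, lpos_cons_succ]

/-- The marginal of the chain is `μ`: `(mchain …).m i = μ (lpos 0 pre ps i)`. [this work] -/
theorem mchain_m (μ : ℕ → ℝ) (v : ℕ → Fin n) (S : ℕ → Finset (Fin n)) (A : Finset (Fin n)) (w : Sym2 (Fin n) → unitInterval) (pre : ℕ)
    (ps : List ℕ) (i : ℕ) : (mchain μ v S A w pre ps).m i = μ (lpos 0 pre ps i) := by
  simp [TwoChain.m, mchain]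

/-- `Σ_{p ∈ qs} 𝟙[s(c, v p) open]·W_p`. [this work] -/
def fstemCountL (c : Fin n) (v : ℕ → Fin n) (S : ℕ → Finset (Fin n)) (A : Finset (Fin n)) (qs : List ℕ) (ω : BondConfig (Fin n)) : ℕ :=
  (qs.map fun p => if s(c, v p) ∈ ω then hubCount v S A p ω else 0).sum

/-- The stems of a list of anchors. [this work] -/
def fstemSet (c : Fin n) (v : ℕ → Fin n) : List ℕ → Finset (Sym2 (Fin n))
  | [] => ∅
  | p :: qs => {s(c, v p)} ∪ fstemSet c v qs

/-- [this work] -/ @[simp] theorem fstemCountL_nil (c : Fin n) (v : ℕ → Fin n) (S : ℕ → Finset (Fin n)) (A : Finset (Fin n)) (ω : BondConfig (Fin n)) :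
    fstemCountL c v S A [] ω = 0 := rfl
/-- [this work] -/ @[simp] theorem fstemCountL_cons (c : Fin n) (v : ℕ → Fin n) (S : ℕ → Finset (Fin n)) (A : Finset (Fin n)) (p : ℕ) (qs : List ℕ)
    (ω : BondConfig (Fin n)) :
    fstemCountL c v S A (p :: qs) ω = (if s(c, v p) ∈ ω then hubCount v S A p ω else 0) + fstemCountL c v S A qs ω := by simp [fstemCountL]
/-- [this work] -/ @[simp] theorem fstemSet_nil (c : Fin n) (v : ℕ → Fin n) : fstemSet c v [] = ∅ := rfl
/-- [this work] -/ @[simp] theorem fstemSet_cons (c : Fin n) (v : ℕ → Fin n) (p : ℕ) (qs : List ℕ) :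
    fstemSet c v (p :: qs) = {s(c, v p)} ∪ fstemSet c v qs := rfl

/-- Membership in `fstemSet`. [this work] -/
theorem mem_fstemSet (c : Fin n) (v : ℕ → Fin n) {qs : List ℕ} {e : Sym2 (Fin n)} : e ∈ fstemSet c v qs ↔ ∃ p ∈ qs, e = s(c, v p) := by
  induction qs with
  | nil => simp
  | cons p qs ih => simp [ih]

/-- `fstemCountL` is read off the stems and hub pairs of the listed anchors. [this work] -/
theorem readsOff_fstemCountL (c : Fin n) (v : ℕ → Fin n) (S : ℕ → Finset (Fin n)) (A : Finset (Fin n)) (qs : List ℕ) :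
    ReadsOff (fstemCountL c v S A qs) (↑(fstemSet c v qs ∪ hubPairsL v S qs)) := by
  induction qs with
  | nil => intro ω ω' _; rfl
  | cons p qs ih =>
    have h1 : ReadsOff (fun ω => if s(c, v p) ∈ ω then hubCount v S A p ω else 0)
        (↑({s(c, v p)} : Finset (Sym2 (Fin n))) ∪ ↑(hubPairs (S p) (v p))) :=
      (readsOff_mem s(c, v p)).map₂ (readsOff_hubCount v S A p) fun (b : Prop) (k : ℕ) => if b then k else 0
    have h := h1.map₂ ih (· + ·)
    intro ω ω' hF
    rw [fstemCountL_cons, fstemCountL_cons]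
    refine h ω ω' ?_
    have hset : (↑({s(c, v p)} : Finset (Sym2 (Fin n))) ∪ ↑(hubPairs (S p) (v p))) ∪ ↑(fstemSet c v qs ∪ hubPairsL v S qs) =
        (↑(fstemSet c v (p :: qs) ∪ hubPairsL v S (p :: qs)) : Set (Sym2 (Fin n))) := by
      simp only [fstemSet_cons, hubPairsL_cons, Finset.coe_union]
      ext e; simp only [Set.mem_union]; tauto
    rw [hset]; exact hF

/-! ## The loaded anchors -/

/-- The loaded indices of `J` (in increasing order). [this work] -/
def floadedList (J : Finset ℕ) (v : ℕ → Fin n) (S : ℕ → Finset (Fin n)) (A : Finset (Fin n)) : List ℕ :=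
  (J.sort (· ≤ ·)).filter fun j => decide (Loaded v S A j)

/-- Membership in the loaded list. [this work] -/
theorem mem_floadedList {J : Finset ℕ} {v : ℕ → Fin n} {S : ℕ → Finset (Fin n)} {A : Finset (Fin n)} {j : ℕ} :
    j ∈ floadedList J v S A ↔ j ∈ J ∧ Loaded v S A j := by
  simp [floadedList, List.mem_filter]

/-- The loaded list has no duplicates. [this work] -/
theorem floadedList_nodup (J : Finset ℕ) (v : ℕ → Fin n) (S : ℕ → Finset (Fin n)) (A : Finset (Fin n)) : (floadedList J v S A).Nodup :=
  (Finset.sort_nodup _ _).filter _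

/-- **The decoupled block count is the stem count over the loaded anchors.** [this work] -/
theorem stemCountF_eq_fstemCountL (c : Fin n) (J : Finset ℕ) (v : ℕ → Fin n) (S : ℕ → Finset (Fin n)) (A : Finset (Fin n)) (ω : BondConfig (Fin n)) :
    stemCountF c J v S A ω = fstemCountL c v S A (floadedList J v S A) ω := by
  unfold stemCountF fstemCountL
  rw [← List.sum_toFinset _ (floadedList_nodup J v S A)]
  symm
  apply Finset.sum_subset
  · intro j hj
    rw [List.mem_toFinset, mem_floadedList] at hj
    exact hj.1
  · intro j hj hjn
    rw [List.mem_toFinset, mem_floadedList] at hjn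
    have hnl : ¬ Loaded v S A j := fun h => hjn ⟨hj, h⟩
    simp [hubCount_eq_zero_of_not_loaded v S A hnl ω]

/-! ## Laws of the stem count -/

section Family

variable {c : Fin n} {Z : Finset (Fin n)} {J : Finset ℕ} {v : ℕ → Fin n} {S : ℕ → Finset (Fin n)} (H : IsHubFamily c Z J v S)
  (w : Sym2 (Fin n) → unitInterval)
include H

/-- Distinct hubs of a family have disjoint pair sets. [this work] -/
theorem disjoint_hubPairs_fd {i j : ℕ} (hi : i ∈ J) (hj : j ∈ J) (hij : i ≠ j) : Disjoint (hubPairs (S i) (v i)) (hubPairs (S j) (v j)) := by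
  rw [Finset.disjoint_left]
  intro e h1 h2
  obtain ⟨-, hin⟩ := (Finset.mem_filter.1 h1).2
  obtain ⟨⟨z, hz, hze⟩, -⟩ := (Finset.mem_filter.1 h2).2
  rcases hin z hze with h | h
  · exact Finset.disjoint_left.1 (H.disj i hi j hj hij) h hz
  · exact H.vS i hi j hj (h ▸ hz)

/-- The stem and hub pairs of an anchor avoid those of a list of other anchors. [this work] -/
theorem disjoint_fstem_hub_rest {p : ℕ} {qs : List ℕ} (hp : p ∈ J) (hqs : ∀ q ∈ qs, q ∈ J) (hpq : p ∉ qs) :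
    Disjoint ({s(c, v p)} ∪ hubPairs (S p) (v p)) (fstemSet c v qs ∪ hubPairsL v S qs) := by
  rw [Finset.disjoint_union_left, Finset.disjoint_union_right, Finset.disjoint_union_right]
  refine ⟨⟨?_, ?_⟩, ?_, ?_⟩
  · rw [Finset.disjoint_singleton_left, mem_fstemSet]
    rintro ⟨q, hq, h⟩
    exact hpq (fstem_index_unique H hp (hqs q hq) h ▸ hq)
  · rw [Finset.disjoint_singleton_left, mem_hubPairsL]
    rintro ⟨q, hq, h⟩
    exact fstem_notMem_hubPairs H hp (hqs q hq) h
  · rw [Finset.disjoint_left]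
    intro e he he'
    obtain ⟨q, hq, rfl⟩ := (mem_fstemSet c v).1 he'
    exact fstem_notMem_hubPairs H (hqs q hq) hp he
  · rw [Finset.disjoint_left]
    intro e he he'
    obtain ⟨q, hq, heq⟩ := (mem_hubPairsL v S).1 he'
    exact Finset.disjoint_left.1 (disjoint_hubPairs_fd H hp (hqs q hq) (fun h => hpq (h ▸ hq))) he heq

/-- **`P_{w'}(fstemCountL ps ≥ 1) = hProd |ps| C` and `P_{w'}(fstemCountL ps ≥ 2) = tProd |ps| C`** for `w' = fdecouple …` and
`C = mchain (j ↦ P_w(c ↔ v j in core)) v S A w pre ps`. [this work] -/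
theorem real_fstemCountL (A : Finset (Fin n)) :
    ∀ (ps : List ℕ) (pre : ℕ), (∀ p ∈ ps, p ∈ J) → ps.Nodup →
      (prodBernoulli (fdecouple c Z J v S w)).real {ω | 1 ≤ fstemCountL c v S A ps ω} =
        hProd ps.length (mchain (fun j => (prodBernoulli w).real {ω | core Z (hubs J S) ω ∈ openConn c (v j)}) v S A w pre ps) ∧
      (prodBernoulli (fdecouple c Z J v S w)).real {ω | 2 ≤ fstemCountL c v S A ps ω} =
        tProd ps.length (mchain (fun j => (prodBernoulli w).real {ω | core Z (hubs J S) ω ∈ openConn c (v j)}) v S A w pre ps) := by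
  have hmeas : ∀ U : Set (BondConfig (Fin n)), MeasurableSet U := fun U => (Set.toFinite U).measurableSet
  set w' := fdecouple c Z J v S w with hw'
  set μ : ℕ → ℝ := fun j => (prodBernoulli w).real {ω | core Z (hubs J S) ω ∈ openConn c (v j)} with hμ
  intro ps
  induction ps with
  | nil =>
    intro pre _ _
    simp only [fstemCountL_nil, List.length_nil, TwoChain.hProd_zero, TwoChain.tProd_zero]
    exact ⟨by simp, by simp⟩
  | cons p ps ih =>
    intro pre hps hnd
    have hp : p ∈ J := hps p (by simp)
    have hps' : ∀ q ∈ ps, q ∈ J := fun q hq => hps q (by simp [hq])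
    have hpps : p ∉ ps := (List.nodup_cons.1 hnd).1
    obtain ⟨ih1, ih2⟩ := ih p hps' (List.nodup_cons.1 hnd).2
    rw [List.length_cons, TwoChain.hProd_succ, TwoChain.tProd_succ, mchain_shift]
    simp only [fstemCountL_cons]
    set V : BondConfig (Fin n) → ℕ := fun ω => if s(c, v p) ∈ ω then hubCount v S A p ω else 0 with hV
    have dV : ∀ P : ℕ → Prop, DeterminedBy {ω | P (V ω)} (↑({s(c, v p)} ∪ hubPairs (S p) (v p)) : Set (Sym2 (Fin n))) := by
      intro P
      have h := ((readsOff_mem s(c, v p)).map₂ (readsOff_hubCount v S A p) fun (b : Prop) (k : ℕ) => if b then k else 0).determinedBy P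
      rw [Finset.coe_union]; exact h
    have dR : ∀ Q : ℕ → Prop, DeterminedBy {ω | Q (fstemCountL c v S A ps ω)} (↑(fstemSet c v ps ∪ hubPairsL v S ps) : Set (Sym2 (Fin n))) :=
      fun Q => (readsOff_fstemCountL c v S A ps).determinedBy Q
    have indep : ∀ (P Q : ℕ → Prop), (prodBernoulli w').real ({ω | P (V ω)} ∩ {ω | Q (fstemCountL c v S A ps ω)}) =
        (prodBernoulli w').real {ω | P (V ω)} * (prodBernoulli w').real {ω | Q (fstemCountL c v S A ps ω)} :=
      fun P Q => prodBernoulli_real_inter_of_determinedBy_disjoint w' (disjoint_fstem_hub_rest H hp hps' hpps) (dV P) (dR Q) (hmeas _) (hmeas _)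
    have dS : DeterminedBy {ω : BondConfig (Fin n) | s(c, v p) ∈ ω} (↑({s(c, v p)} : Finset (Sym2 (Fin n))) : Set (Sym2 (Fin n))) :=
      (readsOff_mem s(c, v p)).determinedBy id
    have dW : ∀ P : ℕ → Prop, DeterminedBy {ω | P (hubCount v S A p ω)} (↑(hubPairs (S p) (v p)) : Set (Sym2 (Fin n))) :=
      fun P => (readsOff_hubCount v S A p).determinedBy P
    have hdSW : Disjoint ({s(c, v p)} : Finset (Sym2 (Fin n))) (hubPairs (S p) (v p)) := by
      rw [Finset.disjoint_singleton_left]; exact fstem_notMem_hubPairs H hp hp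
    have lawV : ∀ P : ℕ → Prop, (prodBernoulli w').real ({ω | s(c, v p) ∈ ω} ∩ {ω | P (hubCount v S A p ω)}) =
        μ p * (prodBernoulli w).real {ω | P (hubCount v S A p ω)} := by
      intro P
      rw [prodBernoulli_real_inter_of_determinedBy_disjoint w' hdSW dS (dW P) (hmeas _) (hmeas _), real_stem_fd H w hp, real_hub_fdecouple H w A hp]
    have hV1 : ∀ k, 1 ≤ k → {ω | k ≤ V ω} = {ω | s(c, v p) ∈ ω} ∩ {ω | k ≤ hubCount v S A p ω} := by
      intro k hk; ext ω; simp only [hV, mem_setOf_eq, Set.mem_inter_iff]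
      by_cases h : s(c, v p) ∈ ω
      · simp [h]
      · simp only [h, if_false, false_and, iff_false, not_le]; omega
    have hVeq1 : {ω | V ω = 1} = {ω | s(c, v p) ∈ ω} ∩ {ω | hubCount v S A p ω = 1} := by
      ext ω; simp only [hV, mem_setOf_eq, Set.mem_inter_iff]
      by_cases h : s(c, v p) ∈ ω
      · simp [h]
      · simp [h]
    have hV0 : (prodBernoulli w').real {ω | V ω = 0} = 1 - μ p * (hs v S A w p + hd v S A w p) := by
      have : {ω | V ω = 0} = {ω | 1 ≤ V ω}ᶜ := by ext ω; simp only [mem_setOf_eq, Set.mem_compl_iff]; omega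
      rw [this, probReal_compl_eq_one_sub (hmeas _), hV1 1 le_rfl, lawV (fun k => 1 ≤ k), real_hubCount_ge_one]
    have hm1 : (mchain μ v S A w pre (p :: ps)).m 1 = μ p := by rw [mchain_m]; simp
    have hu1 : (mchain μ v S A w pre (p :: ps)).u 1 = hs v S A w p + hd v S A w p := by simp [TwoChain.u, mchain]
    have hs1 : (mchain μ v S A w pre (p :: ps)).s 1 = hs v S A w p := by simp [mchain]
    have hd1 : (mchain μ v S A w pre (p :: ps)).d 1 = hd v S A w p := by simp [mchain]
    constructor
    · have e : {ω : BondConfig (Fin n) | 1 ≤ V ω + fstemCountL c v S A ps ω} =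
          {ω | 1 ≤ V ω} ∪ ({ω | V ω = 0} ∩ {ω | 1 ≤ fstemCountL c v S A ps ω}) := by
        ext ω; simp only [mem_setOf_eq, Set.mem_union, Set.mem_inter_iff]; omega
      have hdj : Disjoint {ω : BondConfig (Fin n) | 1 ≤ V ω} ({ω | V ω = 0} ∩ {ω | 1 ≤ fstemCountL c v S A ps ω}) := by
        rw [Set.disjoint_left]; rintro ω h1 ⟨h0, -⟩; simp only [mem_setOf_eq] at h1 h0; omega
      rw [e, measureReal_union hdj (hmeas _), indep (fun k => k = 0) (fun k => 1 ≤ k), ih1, hV0, hV1 1 le_rfl, lawV (fun k => 1 ≤ k),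
        real_hubCount_ge_one, hm1, hu1]
    · have e : {ω : BondConfig (Fin n) | 2 ≤ V ω + fstemCountL c v S A ps ω} =
          ({ω | 2 ≤ V ω} ∪ ({ω | V ω = 1} ∩ {ω | 1 ≤ fstemCountL c v S A ps ω})) ∪ ({ω | V ω = 0} ∩ {ω | 2 ≤ fstemCountL c v S A ps ω}) := by
        ext ω; simp only [mem_setOf_eq, Set.mem_union, Set.mem_inter_iff]; omega
      have hdA : Disjoint {ω : BondConfig (Fin n) | 2 ≤ V ω} ({ω | V ω = 1} ∩ {ω | 1 ≤ fstemCountL c v S A ps ω}) := by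
        rw [Set.disjoint_left]; rintro ω h1 ⟨h0, -⟩; simp only [mem_setOf_eq] at h1 h0; omega
      have hdB : Disjoint ({ω : BondConfig (Fin n) | 2 ≤ V ω} ∪ ({ω | V ω = 1} ∩ {ω | 1 ≤ fstemCountL c v S A ps ω}))
          ({ω | V ω = 0} ∩ {ω | 2 ≤ fstemCountL c v S A ps ω}) := by
        rw [Set.disjoint_left]; rintro ω (h1 | ⟨h1, -⟩) ⟨h0, -⟩ <;> simp only [mem_setOf_eq] at h1 h0 <;> omega
      rw [e, measureReal_union hdB (hmeas _), measureReal_union hdA (hmeas _), indep (fun k => k = 1) (fun k => 1 ≤ k),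
        indep (fun k => k = 0) (fun k => 2 ≤ k), ih1, ih2, hV0, hV1 2 (by norm_num), hVeq1, lawV (fun k => 2 ≤ k), lawV (fun k => k = 1),
        hm1, hu1, hs1, hd1]
      unfold hd hs
      ring

end Family

end Block

end Quant

end Summit.CriticalPhenomena.PercolationContinuityZ3.Theorems
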